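import Literature.AnabelianGeometry.EtaleTheta.Discharge.Sec4Prop42Sub
import Literature.AnabelianGeometry.EtaleTheta.Discharge.Sec3Thm37SubQFT
import Literature.AnabelianGeometry.EtaleTheta.BiKummerOfModelCanonical
import Literature.AnabelianGeometry.EtaleTheta.Discharge.Sec4NonVacuity
import Literature.AnabelianGeometry.EtaleTheta.Discharge.Sec4NonVacuityCovering
import HarnessLib

/-!
# [EtTh] Prop. 4.2 (iv), sub-nodes L07′ `RootUnitTorsion`, L07 `ZetaB`, L08 `BetaCompat`, U1 `ZetaB_unique`,
# U2 `ZetaA_unique_upto_mu` AT THE MODEL INSTANCE of the §4 setting (dictionary = identity)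

Mochizuki, *The étale theta function and its Frobenioid-theoretic manifestations*, Publ. RIMS **45**
(2009) [EtTh], §4, Proposition 4.2 (iv), statement PDF p.89 L1–12, proof p.90 L12–24
[cite: MochizukiEtTh2009, Prop 4.2 p.89].

PROOF-ONLY companion (abc-iut cell, block F, seat abc-iut-f-131; FACT-LIST rows F-2804 `RootUnitTorsion`
(L07′, the `μ_N`-clause «for some `u ∈ μ_N(B_N)`», p.89 L4), F-2801 `BetaCompat` (L08), F-2802
`ZetaB_unique` (U1), F-2803 `ZetaA_unique_upto_mu` (U2) of `Literature/AnabelianGeometry/EtaleTheta/Prop42Sub.lean`,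
and the by-name producer of F-2800 `ZetaB` (L07)).  Nothing of the statements file, of the conditional
theorems of record (`Discharge/Sec4Prop42Sub.lean`, abc-iut-w5-d134: `rootUnitTorsion_of`, `zetaB_of`, …;
`Discharge/Sec4Prop42SubLawFree.lean`, abc-iut-w5-d120: `…_of_isDivisorial`, `…_treeCatVocab`) or of the
model vocabulary (`BiKummerOfModel(Canonical).lean`, abc-iut-L2-t9) is edited or re-proved; no `def`, no
named fact, no instance.

WHAT IS ADDED.  The conditional theorem of record for L07′, `Prop42Sub.rootUnitTorsion_of`, carries — besides
the two structural laws `hΦd` (`Φ` divisorial) and `hBg` (`B` group-like, discharged by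
`ratFnFunctor_isGroupLike_holds`) — the birational DICTIONARY of [FrdI] Thm. 5.2 (ii)
("`O^×(−)` on `C^birat` is `B(−)`"): a homomorphism `toB : O^×(A^birat) → B(A^bs)^×` computing fractions
(`hfrac`) and compatible with the transport parameter `pullFrac` (`hpull`).  Over an ABSTRACT setting
`S : BiKummerSetting X T D VD` the fields `biratUnits` / `fracOf` and the parameter `pullFrac` are
uninterpreted, so L07′ (and L07) are consumed at the instance where print's objects live: abc-iut-L2-t9's
MODEL INSTANCE `mkOfModel` / `mkOfModelCanonical` (`O^×(A^birat) := B(A_D)^×`, `s'·(s'')⁻¹ := u_{s'}·u_{s''}⁻¹`)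
with the genuine transport `pullFracModel` (`((α')^birat)^* := B(Base α')`), at which the dictionary is the
IDENTITY (`toB := id`, `hfrac := coe_fracOfModel_mul_unit`, `hpull := rfl`).  Hence:

* §1 (arbitrary [FrdI] vocabulary `VD`): `rootUnitTorsion_mkOfModel`, `rootUnitTorsion_mkOfModelCanonical`,
  `zetaB_mkOfModel`, `zetaB_mkOfModelCanonical` — L07′ and L07 at the model instance MODULO `Φ` DIVISORIAL ONLY;
* §2 (canonical vocabulary `VD := treeCatVocab D _ _`, where "`Φ` divisorial" is the structure's own field,
  `TemperedFrobenioid.isDivisorial_divisorMonoid`): the same four HYPOTHESIS-FREE, and the typed node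
  `Prop42_iv` at the canonical model modulo L06 `ZetaA` ALONE (`prop42_iv_mkOfModelCanonical_treeCatVocab_of_zetaA`);
* §3 (closed instances, universe 0, trivial vocabularies): at abc-iut-L2-t9/w5's perfect toy `Toy.biKummerSetting`
  (`Φ = ℚ_{≥0}`, p421581) and at abc-iut-w5-d063's Kummer-tower toy `ToyCov.biKummerSetting` (p427822) the five
  sub-nodes L07′, L07, L08, U1, U2 HOLD outright (`Toy.rootUnitTorsion`, …, `ToyCov.zetaA_unique_upto_mu`) —
  L08/U1/U2 for EVERY transport `pullFrac`, L07′/L07 for the genuine `pullFracModel`.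

Every proof is a one-line specialisation of a theorem of record.  HONEST FRAMING: refereed pre-IUT material
([EtTh] 2009); the rows are intermediate statements OF THE PRINTED PROOF typed over a hypothesis structure
whose [FrdI] vocabulary binder `VD` is opaque — their universal closure over `VD` is not asserted here (it
needs `Φ(A)` integral and sharp, which only the canonical vocabulary records); typed ≠ proved; a FACT row is
an assumption label; nothing here bears on or takes a side on [IUTchIII] Cor. 3.12.
-/

namespace Literature.AnabelianGeometry.EtaleTheta

open CategoryTheory Opposite Literature.AlgebraicGeometry.Frobenioids

universe u₀ v₀ u v w

variable {K : Type u₀} [Field K]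

namespace BiKummerSetting

namespace Prop42Sub

/-! ## §1. Arbitrary [FrdI] vocabulary `VD`: L07′ and L07 at the model instance modulo `Φ` divisorial -/

section General

variable (X : SemiGraphs.TemperedArithmeticGroup.{u₀} K) {D₀ : Type u₀} [Category.{v₀} D₀]
  {V : FrdIMonoidStub.{w}} {T : RealifiedDivisorMonoids (D₀ := D₀) V} {D : Type u} [Category.{v} D]
  {VD : FrdICatStub.{u, v, w} D}
  (tf : TemperedFrobenioid T D VD) (hZ : tf.monoidType = MonoidType.Z)
  (hP : ∀ A : Dᵒᵖ, IsPerfect (tf.Φ.carrier A)) (hBΛ : ∀ (Y : D₀ᵒᵖ) (b : T.BΛ.obj Y), IsUnit b)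
  (DS : ∀ {A : Dᵒᵖ}, tf.Φ.carrier A → tf.Φ.carrier A → Prop) (IG : D → Prop)
  (gS : ∀ A : D, IG A → (X.Pi →* Aut A)) (gSs : ∀ (A : D) (h : IG A), Function.Surjective (gS A h))
  (NH : Subgroup (Field.absoluteGaloisGroup K) → tf.category → ℕ+ → Prop)
  (AB : ∀ {A B : tf.category}, Subgroup (Aut A) → (A ⟶ A) → (A ⟶ B) → Prop) (A₀ : tf.category)
  (hA₀ : PreFrobenioid.IsFrobeniusTrivial tf.toElem A₀) (hA₀' : IG A₀.base)

/-- **(iv)/L07′ `RootUnitTorsion` at the MODEL INSTANCE `mkOfModel`** (abc-iut-L2-t9: `O^×(A^birat) := B(A_D)^×`,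
`s'·(s'')⁻¹ := u_{s'}·u_{s''}⁻¹`, transport `pullFracModel`), modulo `Φ` divisorial ONLY: the unit `u ∈ O^×(B_N)`
relating the two denominator squares of two `N`-th roots is `N`-torsion («for some `u ∈ μ_N(B_N)`», p.89 L4)
— `rootUnitTorsion_of` with the identity dictionary (`toB := id`, `hfrac := coe_fracOfModel_mul_unit`,
`hpull := rfl`) and `B` group-like from `hBΛ`. [cite: MochizukiEtTh2009, Prop 4.2 p.89] -/
theorem rootUnitTorsion_mkOfModel (hΦd : Objectwise (fun M _ => IsDivisorial M) tf.divisorMonoid) :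
    RootUnitTorsion (mkOfModel X tf hZ hP hBΛ DS IG gS gSs NH AB A₀ hA₀ hA₀')
      (fun φ x => tf.pullFracModel φ x) := by
  intro B f P N R R' ζA ζB u hu hζ hnum hden
  exact rootUnitTorsion_of (mkOfModel X tf hZ hP hBΛ DS IG gS gSs NH AB A₀ hA₀ hA₀')
    (fun φ x => tf.pullFracModel φ x) hΦd (tf.isGroupLike_ratFnFunctor hBΛ)
    (fun A => MonoidHom.id (tf.biratUnitsModel A))
    (fun s' s'' _ _ _ => coe_fracOfModel_mul_unit tf hBΛ s' s'') (fun _ _ => rfl)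
    f P N R R' ζA ζB u hu hζ hnum hden

/-- **(iv)/L07 `ZetaB` at the MODEL INSTANCE `mkOfModel`**, modulo `Φ` divisorial ONLY: given `ζ_A` over
`α, ᾱ`, the isomorphism `ζ_B : B_N ⥲ B̄_N` and the root of unity `u ∈ μ_N(B_N)` with `s̄'_N ∘ ζ_A = ζ_B ∘ s'_N`,
`s̄''_N ∘ ζ_A = ζ_B ∘ u ∘ s''_N` EXIST (`zetaB_of` = torsion-freeness of `Φ` + [FrdI] Def. 1.3 (iii)(d), fed with
`rootUnitTorsion_mkOfModel`). [cite: MochizukiEtTh2009, Prop 4.2 p.90] -/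
theorem zetaB_mkOfModel (hΦd : Objectwise (fun M _ => IsDivisorial M) tf.divisorMonoid) :
    ZetaB (mkOfModel X tf hZ hP hBΛ DS IG gS gSs NH AB A₀ hA₀ hA₀') (fun φ x => tf.pullFracModel φ x) :=
  zetaB_of (mkOfModel X tf hZ hP hBΛ DS IG gS gSs NH AB A₀ hA₀ hA₀') (fun φ x => tf.pullFracModel φ x) hΦd
    (tf.isGroupLike_ratFnFunctor hBΛ)
    (rootUnitTorsion_mkOfModel X tf hZ hP hBΛ DS IG gS gSs NH AB A₀ hA₀ hA₀' hΦd)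

/-- **(iv)/L07′ `RootUnitTorsion` at the CANONICAL MODEL INSTANCE `mkOfModelCanonical`** (disjoint supports
:= [FrdI] Prop. 4.1 (iii) coprimality, Def. 4.1 (iv)(e) := `TemperedFrobenioid.ArisesFromBaseFrobeniusPair`,
`B₀^Λ` group-like by the structure field `isUnit_BΛ`), modulo `Φ` divisorial ONLY.
[cite: MochizukiEtTh2009, Prop 4.2 p.89] -/
theorem rootUnitTorsion_mkOfModelCanonical
    (hΦd : Objectwise (fun M _ => IsDivisorial M) tf.divisorMonoid) :
    RootUnitTorsion (mkOfModelCanonical X tf hZ hP IG gS gSs NH A₀ hA₀ hA₀')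
      (fun φ x => tf.pullFracModel φ x) :=
  rootUnitTorsion_mkOfModel X tf hZ hP T.isUnit_BΛ _ IG gS gSs NH _ A₀ hA₀ hA₀' hΦd

/-- **(iv)/L07 `ZetaB` at the CANONICAL MODEL INSTANCE**, modulo `Φ` divisorial ONLY.
[cite: MochizukiEtTh2009, Prop 4.2 p.90] -/
theorem zetaB_mkOfModelCanonical (hΦd : Objectwise (fun M _ => IsDivisorial M) tf.divisorMonoid) :
    ZetaB (mkOfModelCanonical X tf hZ hP IG gS gSs NH A₀ hA₀ hA₀') (fun φ x => tf.pullFracModel φ x) :=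
  zetaB_mkOfModel X tf hZ hP T.isUnit_BΛ _ IG gS gSs NH _ A₀ hA₀ hA₀' hΦd

end General

/-! ## §2. The canonical vocabulary `treeCatVocab`: L07′, L07 at the model instance, HYPOTHESIS-FREE -/

section TreeVocab

variable (X : SemiGraphs.TemperedArithmeticGroup.{u₀} K) {D₀ : Type u₀} [Category.{v₀} D₀]
  {V : FrdIMonoidStub.{w}} {T : RealifiedDivisorMonoids (D₀ := D₀) V} {D : Type u} [Category.{v} D]
  {IsRational IsStrictlyRational : (Dᵒᵖ ⥤ CommMonCat.{w}) → Prop}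
  (tf : TemperedFrobenioid T D (treeCatVocab D IsRational IsStrictlyRational))
  (hZ : tf.monoidType = MonoidType.Z)
  (hP : ∀ A : Dᵒᵖ, IsPerfect (tf.Φ.carrier A)) (hBΛ : ∀ (Y : D₀ᵒᵖ) (b : T.BΛ.obj Y), IsUnit b)
  (DS : ∀ {A : Dᵒᵖ}, tf.Φ.carrier A → tf.Φ.carrier A → Prop) (IG : D → Prop)
  (gS : ∀ A : D, IG A → (X.Pi →* Aut A)) (gSs : ∀ (A : D) (h : IG A), Function.Surjective (gS A h))
  (NH : Subgroup (Field.absoluteGaloisGroup K) → tf.category → ℕ+ → Prop)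
  (AB : ∀ {A B : tf.category}, Subgroup (Aut A) → (A ⟶ A) → (A ⟶ B) → Prop) (A₀ : tf.category)
  (hA₀ : PreFrobenioid.IsFrobeniusTrivial tf.toElem A₀) (hA₀' : IG A₀.base)

/-- **(iv)/L07′ `RootUnitTorsion` — UNCONDITIONAL at the model instance over the canonical [FrdI] vocabulary**
(`Φ` divisorial is the structure field `isDivisorialOn`, read by `TemperedFrobenioid.isDivisorial_divisorMonoid`).
[cite: MochizukiEtTh2009, Prop 4.2 p.89] -/
theorem rootUnitTorsion_mkOfModel_treeCatVocab :
    RootUnitTorsion (mkOfModel X tf hZ hP hBΛ DS IG gS gSs NH AB A₀ hA₀ hA₀')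
      (fun φ x => tf.pullFracModel φ x) :=
  rootUnitTorsion_mkOfModel X tf hZ hP hBΛ DS IG gS gSs NH AB A₀ hA₀ hA₀' tf.isDivisorial_divisorMonoid

/-- **(iv)/L07 `ZetaB` — UNCONDITIONAL at the model instance over the canonical vocabulary.**
[cite: MochizukiEtTh2009, Prop 4.2 p.90] -/
theorem zetaB_mkOfModel_treeCatVocab :
    ZetaB (mkOfModel X tf hZ hP hBΛ DS IG gS gSs NH AB A₀ hA₀ hA₀') (fun φ x => tf.pullFracModel φ x) :=
  zetaB_mkOfModel X tf hZ hP hBΛ DS IG gS gSs NH AB A₀ hA₀ hA₀' tf.isDivisorial_divisorMonoid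

/-- **(iv)/L07′ `RootUnitTorsion` — UNCONDITIONAL at the canonical model instance over the canonical vocabulary.**
[cite: MochizukiEtTh2009, Prop 4.2 p.89] -/
theorem rootUnitTorsion_mkOfModelCanonical_treeCatVocab :
    RootUnitTorsion (mkOfModelCanonical X tf hZ hP IG gS gSs NH A₀ hA₀ hA₀')
      (fun φ x => tf.pullFracModel φ x) :=
  rootUnitTorsion_mkOfModelCanonical X tf hZ hP IG gS gSs NH A₀ hA₀ hA₀' tf.isDivisorial_divisorMonoid

/-- **(iv)/L07 `ZetaB` — UNCONDITIONAL at the canonical model instance over the canonical vocabulary.**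
[cite: MochizukiEtTh2009, Prop 4.2 p.90] -/
theorem zetaB_mkOfModelCanonical_treeCatVocab :
    ZetaB (mkOfModelCanonical X tf hZ hP IG gS gSs NH A₀ hA₀ hA₀') (fun φ x => tf.pullFracModel φ x) :=
  zetaB_mkOfModelCanonical X tf hZ hP IG gS gSs NH A₀ hA₀ hA₀' tf.isDivisorial_divisorMonoid

/-- **The typed node `Prop42_iv` at the canonical model instance over the canonical vocabulary, modulo L06
`ZetaA` ALONE** (L07/L07′/L08 are theorems there; `prop42_iv_mkOfModel_of_zetaA` with `Φ` divisorial read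
from the structure). [cite: MochizukiEtTh2009, Prop 4.2 p.89] -/
theorem prop42_iv_mkOfModelCanonical_treeCatVocab_of_zetaA
    (h₆ : ZetaA (mkOfModelCanonical X tf hZ hP IG gS gSs NH A₀ hA₀ hA₀') (fun φ x => tf.pullFracModel φ x)) :
    (mkOfModelCanonical X tf hZ hP IG gS gSs NH A₀ hA₀ hA₀').Prop42_iv (fun φ x => tf.pullFracModel φ x) :=
  prop42_iv_mkOfModel_of_zetaA tf hZ hP T.isUnit_BΛ _ IG gS gSs NH _ A₀ hA₀ hA₀'
    tf.isDivisorial_divisorMonoid h₆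

end TreeVocab

end Prop42Sub

end BiKummerSetting

/-! ## §3. Closed instances (universe 0): the five sub-nodes HOLD at the two §4 toy settings -/

namespace Toy

open scoped NNRat

/-- **L07′ `RootUnitTorsion` HOLDS at the perfect toy** `Toy.biKummerSetting` (`Φ = ℚ_{≥0}` divisorial by
`divisorMonoidQ_isDivisorial`; transport `pullFracModel`). [cite: MochizukiEtTh2009, Prop 4.2 p.89] -/
theorem rootUnitTorsion :
    BiKummerSetting.Prop42Sub.RootUnitTorsion biKummerSetting
      (fun φ x => temperedFrobenioidQ.pullFracModel φ x) :=
  BiKummerSetting.Prop42Sub.rootUnitTorsion_mkOfModelCanonical temperedGroup temperedFrobenioidQ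
    temperedFrobenioidQ_monoidType temperedFrobenioidQ_isPerfect (fun _ => True) (fun _ _ => 1)
    (fun _ _ _ => ⟨1, Subsingleton.elim (h := ⟨fun _ _ => Iso.ext (Subsingleton.elim _ _)⟩) _ _⟩)
    (fun _ _ _ => True) Aodot isFrobeniusTrivial_Aodot trivial divisorMonoidQ_isDivisorial

/-- **L07 `ZetaB` HOLDS at the perfect toy** (transport `pullFracModel`). [cite: MochizukiEtTh2009, Prop 4.2 p.90] -/
theorem zetaB :
    BiKummerSetting.Prop42Sub.ZetaB biKummerSetting (fun φ x => temperedFrobenioidQ.pullFracModel φ x) :=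
  BiKummerSetting.Prop42Sub.zetaB_mkOfModelCanonical temperedGroup temperedFrobenioidQ
    temperedFrobenioidQ_monoidType temperedFrobenioidQ_isPerfect (fun _ => True) (fun _ _ => 1)
    (fun _ _ _ => ⟨1, Subsingleton.elim (h := ⟨fun _ _ => Iso.ext (Subsingleton.elim _ _)⟩) _ _⟩)
    (fun _ _ _ => True) Aodot isFrobeniusTrivial_Aodot trivial divisorMonoidQ_isDivisorial

variable (pullFrac : ∀ {A A' : biKummerSetting.C} (_ : A' ⟶ A),
  biKummerSetting.biratUnits A → biKummerSetting.biratUnits A')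

/-- **L08 `BetaCompat` HOLDS at the perfect toy, for EVERY transport `pullFrac`.**
[cite: MochizukiEtTh2009, Prop 4.2 p.89] -/
theorem betaCompat : BiKummerSetting.Prop42Sub.BetaCompat biKummerSetting pullFrac :=
  BiKummerSetting.Prop42Sub.betaCompat_of biKummerSetting pullFrac divisorMonoidQ_isDivisorial
    (temperedFrobenioidQ.isGroupLike_ratFnFunctor realifiedQ.isUnit_BΛ)

/-- **U1 `ZetaB_unique` HOLDS at the perfect toy, for EVERY transport `pullFrac`.**
[cite: MochizukiEtTh2009, Prop 4.2 p.89] -/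
theorem zetaB_unique : BiKummerSetting.Prop42Sub.ZetaB_unique biKummerSetting pullFrac :=
  BiKummerSetting.Prop42Sub.zetaB_unique_of biKummerSetting pullFrac divisorMonoidQ_isDivisorial
    (temperedFrobenioidQ.isGroupLike_ratFnFunctor realifiedQ.isUnit_BΛ)

/-- **U2 `ZetaA_unique_upto_mu` HOLDS at the perfect toy, for EVERY transport `pullFrac`.**
[cite: MochizukiEtTh2009, Prop 4.2 p.89] -/
theorem zetaA_unique_upto_mu : BiKummerSetting.Prop42Sub.ZetaA_unique_upto_mu biKummerSetting pullFrac :=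
  BiKummerSetting.Prop42Sub.zetaA_unique_upto_mu_of biKummerSetting pullFrac divisorMonoidQ_isDivisorial
    (temperedFrobenioidQ.isGroupLike_ratFnFunctor realifiedQ.isUnit_BΛ)

end Toy

namespace ToyCov

/-- **L07′ `RootUnitTorsion` HOLDS at the Kummer-tower toy** `ToyCov.biKummerSetting` (abc-iut-w5-d063; `Φ =
ℚ_{≥0}` divisorial by `divisorMonoid_isDivisorial`; transport `pullFracModel`). [cite: MochizukiEtTh2009, Prop 4.2 p.89] -/
theorem rootUnitTorsion :
    BiKummerSetting.Prop42Sub.RootUnitTorsion biKummerSetting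
      (fun φ x => temperedFrobenioid.pullFracModel φ x) :=
  BiKummerSetting.Prop42Sub.rootUnitTorsion_mkOfModelCanonical Toy.temperedGroup temperedFrobenioid
    temperedFrobenioid_monoidType temperedFrobenioid_isPerfect (fun _ => True) (fun _ _ => 1)
    galoisSurj_surjective (fun _ _ _ => True) Aodot isFrobeniusTrivial_Aodot trivial divisorMonoid_isDivisorial

/-- **L07 `ZetaB` HOLDS at the Kummer-tower toy** (transport `pullFracModel`). [cite: MochizukiEtTh2009, Prop 4.2 p.90] -/
theorem zetaB :
    BiKummerSetting.Prop42Sub.ZetaB biKummerSetting (fun φ x => temperedFrobenioid.pullFracModel φ x) :=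
  BiKummerSetting.Prop42Sub.zetaB_mkOfModelCanonical Toy.temperedGroup temperedFrobenioid
    temperedFrobenioid_monoidType temperedFrobenioid_isPerfect (fun _ => True) (fun _ _ => 1)
    galoisSurj_surjective (fun _ _ _ => True) Aodot isFrobeniusTrivial_Aodot trivial divisorMonoid_isDivisorial

variable (pullFrac : ∀ {A A' : biKummerSetting.C} (_ : A' ⟶ A),
  biKummerSetting.biratUnits A → biKummerSetting.biratUnits A')

/-- **L08 `BetaCompat` HOLDS at the Kummer-tower toy, for EVERY transport `pullFrac`.**
[cite: MochizukiEtTh2009, Prop 4.2 p.89] -/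
theorem betaCompat : BiKummerSetting.Prop42Sub.BetaCompat biKummerSetting pullFrac :=
  BiKummerSetting.Prop42Sub.betaCompat_of biKummerSetting pullFrac divisorMonoid_isDivisorial
    ratFnFunctor_isGroupLike

/-- **U1 `ZetaB_unique` HOLDS at the Kummer-tower toy, for EVERY transport `pullFrac`.**
[cite: MochizukiEtTh2009, Prop 4.2 p.89] -/
theorem zetaB_unique : BiKummerSetting.Prop42Sub.ZetaB_unique biKummerSetting pullFrac :=
  BiKummerSetting.Prop42Sub.zetaB_unique_of biKummerSetting pullFrac divisorMonoid_isDivisorial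
    ratFnFunctor_isGroupLike

/-- **U2 `ZetaA_unique_upto_mu` HOLDS at the Kummer-tower toy, for EVERY transport `pullFrac`.**
[cite: MochizukiEtTh2009, Prop 4.2 p.89] -/
theorem zetaA_unique_upto_mu : BiKummerSetting.Prop42Sub.ZetaA_unique_upto_mu biKummerSetting pullFrac :=
  BiKummerSetting.Prop42Sub.zetaA_unique_upto_mu_of biKummerSetting pullFrac divisorMonoid_isDivisorial
    ratFnFunctor_isGroupLike

end ToyCov

end Literature.AnabelianGeometry.EtaleTheta
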